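import Summits.QuantumAdvantage.QuantumAdvantage.Theorems.CubicForrelationNearExactIsExactTwelveLevelFiveTame

/-!
# Crux `CubicForrelation.NearExactIsExact` (stmt-QuantumAdvantage-14043) — n = 12: the odd-kind wild set of a hypothetical pair in the window top

Certificate seat `b2b-cforr-cert` (gen 13).  HONEST FRAMING: a kernel-checked STRUCTURE THEOREM (standard axioms) about cubic Boolean pairs on
12 bits, quantifying `window_twelve_structure`; NOT summit progress.

`window_twelve_wildset`: cubic `f, g`, `W_g = 32u'` with an odd value, `59/64 < Φ < 1`; `e = u' − 2(−1)^f`, `Ω = {u' odd, e ≡ ±3 (8)}`.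
Then `#Ω ≥ 32`, `8·#Ω ≤ 2¹⁵(1 − Φ) − 2048 < 512`, and `Ω` has even intersection with every parametrised 7-flat of the hyperplane `{u' odd}`
(directions in its stabiliser) — `1_Ω ∈ RM(6,11)` on the hyperplane, so `Ω` is a 5-flat (weight 32) or a Kasami–Tokura configuration of
weight `48…62`.  Proof: `e = 0` off the hyperplane (`tw5_off_flat_all`), cubic digit `tw5_digit` (`e = σ + 4ω`, `Ω = {ω odd}`), 7-flat
sums `16 ∣ Σe`, `8 ∣ Σσ` (Ax), `ws_erm_round` (r = 6), and `tw5_levelFive_lt_of_tame` to exclude `Ω = ∅`.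

References: Ax (1964) / McEliece (1972); Kasami–Tokura (1970); MacWilliams–Sloane (1977) Ch. 13–15; Carlet (2021).
-/

set_option linter.dupNamespace false -- D-0017: single-problem summit ⇒ `QuantumAdvantage.QuantumAdvantage` by design

noncomputable section

namespace Summit.QuantumAdvantage.QuantumAdvantage.Theorems.CubicForrelation.NearExactIsExact

open Finset
open Literature.Computability.QuantumComplexity
open Literature.Computability.QuantumComplexity.BuzetChailloux (bxor zeroVec bxor_bxor_cancel_left bxor_zeroVec zeroVec_bxor bxor_comm
  bxor_self twist_zeroVec_right)
open Literature.Computability.QuantumComplexity.DerivativeWalsh (W)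

/-! ### The theorem -/

/-- **The odd-kind wild set in the window top.**  Cubic `f, g` on 12 bits, `W_g = 32·u'` with an odd value, `59/64 < Φ(f,g) < 1`;
`e = u' − 2(−1)^f`, `Ω = {u' odd, e ≡ ±3 (mod 8)}`.  Then (i) `#Ω ≥ 32`, (ii) `8·#Ω ≤ 2¹⁵(1 − Φ) − 2048 (< 512)`, (iii) `Ω` meets every
parametrised 7-flat of the odd hyperplane (directions stabilising `{u' odd}`) in an even number of parameters — i.e. `1_Ω` lies in the
Reed–Muller code `RM(6, 11)` of the hyperplane.  Structure theorem; NOT summit progress. [this work] -/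
theorem window_twelve_wildset (f g : (Fin (6 + 6) → Bool) → Bool) (hf : IsDegLeFun 3 f) (hg : IsDegLeFun 3 g)
    (u' : (Fin (6 + 6) → Bool) → ℤ) (hu' : ∀ x, W (fun y => signOf (g y)) x = (2 : ℝ) ^ 5 * (u' x : ℝ))
    (hodd : ∃ x, Odd (u' x)) (hΦ : (59 / 64 : ℝ) < forrelation f g) (hlt : forrelation f g < 1) :
    32 ≤ #(univ.filter fun x : Fin (6 + 6) → Bool => Odd (u' x) ∧
        ((8 : ℤ) ∣ u' x - 2 * sZ (f x) - 3 ∨ (8 : ℤ) ∣ u' x - 2 * sZ (f x) + 3)) ∧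
    8 * (#(univ.filter fun x : Fin (6 + 6) → Bool => Odd (u' x) ∧
        ((8 : ℤ) ∣ u' x - 2 * sZ (f x) - 3 ∨ (8 : ℤ) ∣ u' x - 2 * sZ (f x) + 3)) : ℝ) ≤ 32768 * (1 - forrelation f g) - 2048 ∧
    ∀ x, Odd (u' x) → ∀ a : Fin 7 → Fin (6 + 6) → Bool, (∀ i y, Odd (u' (bxor y (a i))) ↔ Odd (u' y)) →
      Even #((univ : Finset (Fin 7 → Bool)).filter fun ε =>
        (8 : ℤ) ∣ u' (fun j => x j ^^ decide (Odd #(univ.filter fun i => ε i && a i j))) -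
            2 * sZ (f (fun j => x j ^^ decide (Odd #(univ.filter fun i => ε i && a i j)))) - 3 ∨
        (8 : ℤ) ∣ u' (fun j => x j ^^ decide (Odd #(univ.filter fun i => ε i && a i j))) -
            2 * sZ (f (fun j => x j ^^ decide (Odd #(univ.filter fun i => ε i && a i j)))) + 3) := by
  classical
  -- `u = 2u'` at the Ax level `4`; residual `e = u' − 2s`, budget `B = Σ e² = 2¹⁵(1 − Φ) ∈ (2048, 2208]`
  set u : (Fin (6 + 6) → Bool) → ℤ := fun x => 2 * u' x with hudef
  have hu : ∀ x, W (fun y => signOf (g y)) x = (2 : ℝ) ^ 4 * (u x : ℝ) := by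
    intro x; rw [hu' x]; simp only [u]; push_cast; ring
  set e : (Fin (6 + 6) → Bool) → ℤ := fun x => u' x - 2 * sZ (f x) with hedef
  have hbud := tw12_budget f g u hu
  have h4e : ∀ x, (u x - 4 * sZ (f x)) ^ 2 = 4 * e x ^ 2 := fun x => by simp only [u, e]; ring
  have hBR : ((∑ x, e x ^ 2 : ℤ) : ℝ) = 32768 * (1 - forrelation f g) := by
    have h' : ((∑ x, (u x - 4 * sZ (f x)) ^ 2 : ℤ) : ℝ) = 4 * ((∑ x, e x ^ 2 : ℤ) : ℝ) := by
      rw [sum_congr rfl fun x _ => h4e x, ← mul_sum]; push_cast; ring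
    rw [h'] at hbud
    linarith
  have hB_le : (∑ x, e x ^ 2 : ℤ) ≤ 2559 := by
    have h' : ((∑ x, e x ^ 2 : ℤ) : ℝ) < 2560 := by rw [hBR]; linarith
    have h'' : (∑ x, e x ^ 2 : ℤ) < 2560 := by exact_mod_cast h'
    omega
  -- the odd set `P` of `u'` is an affine hyperplane
  have hℓ : IsDegLeFun 1 (fun x => decide (Odd (u' x))) :=
    stub_walshTower stub_axParity (6 + 6) 5 1 g u' hg hu' (by intro k hk hkn; omega)
  set P := univ.filter (fun x : Fin (6 + 6) → Bool => Odd (u' x)) with hPdef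
  have hmemP : ∀ x, x ∈ P ↔ Odd (u' x) := fun x => by simp [hPdef]
  have heodd : ∀ x, x ∈ P → Odd (e x) := by
    intro x hx
    exact Int.odd_sub.2 (iff_of_true ((hmemP x).1 hx) ⟨sZ (f x), two_mul _⟩)
  have hsq1 : ∀ x, x ∈ P → 1 ≤ e x ^ 2 := by
    intro x hx
    have h0 := Int.odd_iff.1 (heodd x hx)
    have : e x ≤ -1 ∨ 1 ≤ e x := by omega
    have := tp_sq_ge (k := 1) (by norm_num) this
    linarith
  have hsplit : (∑ x, e x ^ 2 : ℤ) = ∑ x ∈ P, e x ^ 2 + ∑ x ∈ univ.filter (fun x => x ∉ P), e x ^ 2 := by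
    rw [← sum_filter_add_sum_filter_not univ (fun x => x ∈ P)]
    congr 1
    exact sum_congr (by ext x; simp) fun _ _ => rfl
  have hoff_nn : 0 ≤ ∑ x ∈ univ.filter (fun x => x ∉ P), e x ^ 2 := sum_nonneg fun x _ => sq_nonneg _
  have hPle : (#P : ℤ) ≤ 2559 := by
    have h1 : (#P : ℤ) = ∑ x ∈ P, (1 : ℤ) := by rw [sum_const, nsmul_eq_mul, mul_one]
    have h2 : ∑ x ∈ P, (1 : ℤ) ≤ ∑ x ∈ P, e x ^ 2 := sum_le_sum fun x hx => hsq1 x hx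
    linarith
  have hfilt : (univ.filter fun x : Fin (6 + 6) → Bool => decide (Odd (u' x)) = true) = P := filter_congr fun x _ => by simp
  have hPge : 2048 ≤ #P := by
    obtain ⟨x₁, hx₁⟩ := hodd
    have hRM := bb_rmWeight_holds (6 + 6) 1 (fun x => decide (Odd (u' x))) hℓ ⟨x₁, decide_eq_true hx₁⟩
    rw [hfilt] at hRM
    norm_num at hRM
    omega
  have hPc : 2048 ≤ #(univ.filter fun x : Fin (6 + 6) → Bool => x ∉ P) := by
    have hPlt : #P < 4096 := by
      have hlt' : (#P : ℤ) < 4096 := by linarith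
      exact_mod_cast hlt'
    have hne : ∃ x, x ∉ P := by
      by_contra hall
      push Not at hall
      have : #P = 4096 := by
        rw [show P = univ from eq_univ_of_forall hall, card_univ, Fintype.card_fun, Fintype.card_bool, Fintype.card_fin]; norm_num
      omega
    obtain ⟨x₂, hx₂⟩ := hne
    have hℓ' : IsDegLeFun 1 (fun x => decide (Odd (u' x)) ^^ true) := tb_isDegLeFun_xor_const hℓ true
    have hRM := bb_rmWeight_holds (6 + 6) 1 (fun x => decide (Odd (u' x)) ^^ true) hℓ'
      ⟨x₂, by have := (hmemP x₂).not.1 hx₂; simpa using this⟩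
    have hfilt' : (univ.filter fun x : Fin (6 + 6) → Bool => (decide (Odd (u' x)) ^^ true) = true) =
        univ.filter fun x : Fin (6 + 6) → Bool => x ∉ P := filter_congr fun x _ => by rw [hmemP]; simp
    rw [hfilt'] at hRM
    norm_num at hRM ⊢
    omega
  have hcardP : #P = 2048 := by
    have htot : #P + #(univ.filter fun x : Fin (6 + 6) → Bool => x ∉ P) = 4096 := by
      have h := Finset.card_filter_add_card_filter_not (s := (univ : Finset (Fin (6 + 6) → Bool))) (fun x => x ∈ P)
      rw [card_univ, Fintype.card_fun, Fintype.card_bool, Fintype.card_fin] at h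
      have e1 : (univ.filter fun x : Fin (6 + 6) → Bool => x ∈ P) = P := by ext x; simp
      rw [e1] at h
      norm_num at h
      exact h
    omega
  -- `P` is a coset of an xor-closed `V` with `2¹¹` elements
  have hmw := mw_flat_of_minweight 0 (fun x => decide (Odd (u' x))) hℓ (by rw [hfilt, hcardP]; norm_num)
  rw [hfilt] at hmw
  obtain ⟨h0, hadd, hcardV, hcoset⟩ := hmw
  set V := univ.filter (fun a : Fin (6 + 6) → Bool => ∀ x, decide (Odd (u' (bxor x a))) = decide (Odd (u' x))) with hV
  obtain ⟨xP, hxP⟩ : P.Nonempty := card_pos.1 (by rw [hcardP]; norm_num)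
  have hS : P = V.image (bxor xP) := hcoset xP (decide_eq_true ((hmemP xP).1 hxP))
  rw [hcardP] at hcardV
  have hcardV11 : #V = 2 ^ 11 := by rw [hcardV]; norm_num
  have hPV : ∀ x, x ∈ P → ∀ a ∈ V, bxor x a ∈ P := fun x hx a ha => fl1_coset_vadd hadd hS hx ha
  -- the residual vanishes off `P` (`tw5_off_flat_all`)
  have hoff0 : ∀ y, y ∉ P → e y = 0 := fun y hy => by
    have h := tw5_off_flat_all f g hf hg u' hu' hodd hΦ y (fun h' => hy ((hmemP y).2 h'))
    simp only [e]; linarith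
  -- the digit `D`, the sign `σ = −(−1)^D ≡ e (mod 4)` on `P`, and the wild part `ω`
  have hD : IsDegLeFun 3 (fun x => decide (Odd (u' x / 2))) := tw5_digit g hg u' hu' hℓ
  set σ : (Fin (6 + 6) → Bool) → ℤ := fun x => - sZ (decide (Odd (u' x / 2))) with hσ
  set ω : (Fin (6 + 6) → Bool) → ℤ := fun x => (e x - σ x) / 4 with hω
  have hσval : ∀ x, σ x = 1 ∨ σ x = -1 := by
    intro x; simp only [σ]; rcases tp_sZ_cases (decide (Odd (u' x / 2))) with h | h <;> rw [h] <;> norm_num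
  have hdec : ∀ x, x ∈ P → e x = σ x + 4 * ω x := by
    intro x hx
    have h1 := Int.odd_iff.1 ((hmemP x).1 hx)
    have h4 : (4 : ℤ) ∣ e x - σ x := by
      simp only [e, σ]
      rcases tp_sZ_cases (f x) with hs | hs <;> rw [hs]
      · by_cases hq : Odd (u' x / 2)
        · have hq' := Int.odd_iff.1 hq
          simp only [hq, decide_true, sZ, if_true]; omega
        · have hq' : u' x / 2 % 2 = 0 := Int.even_iff.1 (Int.not_odd_iff_even.1 hq)
          simp only [hq, decide_false, sZ, Bool.false_eq_true, if_false]; omega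
      · by_cases hq : Odd (u' x / 2)
        · have hq' := Int.odd_iff.1 hq
          simp only [hq, decide_true, sZ, if_true]; omega
        · have hq' : u' x / 2 % 2 = 0 := Int.even_iff.1 (Int.not_odd_iff_even.1 hq)
          simp only [hq, decide_false, sZ, Bool.false_eq_true, if_false]; omega
    have := Int.mul_ediv_cancel' h4
    simp only [ω]
    linarith
  have hΩiff : ∀ x, x ∈ P → (Odd (ω x) ↔ ((8 : ℤ) ∣ e x - 3 ∨ (8 : ℤ) ∣ e x + 3)) := by
    intro x hx
    have hd := hdec x hx
    rw [Int.odd_iff]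
    constructor
    · intro ho
      rcases hσval x with hs | hs <;> rw [hs] at hd
      · right; exact ⟨(ω x + 1) / 2, by omega⟩
      · left; exact ⟨(ω x - 1) / 2, by omega⟩
    · rintro (⟨k, hk⟩ | ⟨k, hk⟩) <;> rcases hσval x with hs | hs <;> rw [hs] at hd <;> omega
  -- 7-flat sums inside `P`: `16 ∣ Σ e`, `8 ∣ Σ σ`, hence `Σ ω` is even
  have hflat7 : ∀ (b : Fin (6 + 6) → Bool) (a : Fin 7 → Fin (6 + 6) → Bool),
      (16 : ℤ) ∣ ∑ ε : Fin 7 → Bool, e (fun j => b j ^^ decide (Odd #(univ.filter fun i => ε i && a i j))) := by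
    intro b a
    have h1 := fs_flat_sum_dvd (e := 5) g u hg hu b a (by norm_num)
    obtain ⟨zf, hzf⟩ := sl_sum_sZ_flat f hf b a
    have hzf' : ∑ ε : Fin 7 → Bool, 2 * sZ (f (fun j => b j ^^ decide (Odd #(univ.filter fun i => ε i && a i j)))) = 16 * zf := by
      rw [← mul_sum, hzf]; norm_num; ring
    have h1' : 2 * 16 ∣ 2 * ∑ ε : Fin 7 → Bool, u' (fun j => b j ^^ decide (Odd #(univ.filter fun i => ε i && a i j))) := by
      rw [mul_sum]; norm_num at h1 ⊢; exact h1
    have h1'' := (mul_dvd_mul_iff_left (two_ne_zero (α := ℤ))).1 h1'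
    have h3 : ∑ ε : Fin 7 → Bool, e (fun j => b j ^^ decide (Odd #(univ.filter fun i => ε i && a i j))) =
        ∑ ε : Fin 7 → Bool, u' (fun j => b j ^^ decide (Odd #(univ.filter fun i => ε i && a i j))) -
        ∑ ε : Fin 7 → Bool, 2 * sZ (f (fun j => b j ^^ decide (Odd #(univ.filter fun i => ε i && a i j)))) := by
      rw [← sum_sub_distrib]
    rw [h3, hzf']
    exact dvd_sub h1'' (Dvd.intro _ rfl)
  -- 7-flat parity of `Ω` (directions in the stabiliser `V`)
  have hpar7 : ∀ b ∈ P, ∀ a : Fin (6 + 1) → Fin (6 + 6) → Bool, (∀ i, a i ∈ V) →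
      (2 : ℤ) ∣ ∑ ε : Fin (6 + 1) → Bool, ω (fun j => b j ^^ decide (Odd #(univ.filter fun i => ε i && a i j))) := by
    intro b hb a ha
    have hpts : ∀ ε : Fin (6 + 1) → Bool, (fun j => b j ^^ decide (Odd #(univ.filter fun i => ε i && a i j))) ∈ P :=
      fun ε => ws_flatPt_mem V h0 (· ∈ P) hPV (6 + 1) b hb a ha ε
    have h16 := hflat7 b a
    obtain ⟨zσ, hzσ⟩ := sl_sum_sZ_flat (fun x => decide (Odd (u' x / 2))) hD b a
    have hσsum : ∑ ε : Fin (6 + 1) → Bool, σ (fun j => b j ^^ decide (Odd #(univ.filter fun i => ε i && a i j))) = - (8 * zσ) := by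
      simp only [σ]; rw [sum_neg_distrib, hzσ]; norm_num
    rw [sum_congr rfl fun ε _ => hdec _ (hpts ε), sum_add_distrib, ← mul_sum, hσsum] at h16
    obtain ⟨k, hk⟩ := h16
    exact ⟨2 * k + zσ, by linarith⟩
  have hmemV : ∀ a : Fin (6 + 6) → Bool, (∀ y, Odd (u' (bxor y a)) ↔ Odd (u' y)) → a ∈ V := by
    intro a ha
    simp only [hV, mem_filter, mem_univ, true_and]
    intro y
    rw [Bool.decide_congr (ha y)]
  refine ⟨?_, ?_, ?_⟩
  · -- (i) `#Ω ≥ 32`: Reed–Muller on the abstract flat (r = 6); `Ω = ∅` would make the side tame, hence exact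
    rcases ws_erm_round V h0 hadd hcardV11 xP ω 6 (fun b hb a ha => hpar7 b (by rwa [hS]) a ha) with hev | hbig
    · exfalso
      have htame : ∀ x, Odd (u' x) → (8 : ℤ) ∣ u' x - 2 * sZ (f x) - 1 ∨ (8 : ℤ) ∣ u' x - 2 * sZ (f x) + 1 := by
        intro x hx
        have hxP := (hmemP x).2 hx
        obtain ⟨r, hr⟩ := hev x (by rw [← hS]; exact hxP)
        have hd := hdec x hxP
        have he' : u' x - 2 * sZ (f x) = e x := rfl
        rw [he']
        rcases hσval x with hs | hs <;> rw [hs] at hd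
        · left; exact ⟨r, by omega⟩
        · right; exact ⟨r, by omega⟩
      have h1 := tw5_levelFive_lt_of_tame f g hf hg u' hu' hodd htame hΦ
      linarith
    · rw [← hS] at hbig
      have hset : P.filter (fun x => Odd (ω x)) = univ.filter (fun x : Fin (6 + 6) → Bool => Odd (u' x) ∧
          ((8 : ℤ) ∣ u' x - 2 * sZ (f x) - 3 ∨ (8 : ℤ) ∣ u' x - 2 * sZ (f x) + 3)) := by
        ext x
        simp only [mem_filter, mem_univ, true_and]
        constructor
        · rintro ⟨hx, ho⟩; exact ⟨(hmemP x).1 hx, (hΩiff x hx).1 ho⟩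
        · rintro ⟨hx, hc⟩; exact ⟨(hmemP x).2 hx, (hΩiff x ((hmemP x).2 hx)).2 hc⟩
      rw [hset] at hbig
      norm_num at hbig ⊢
      omega
  · -- (ii) cost: every point of `Ω` has `e² − 1 ≥ 8`, and `Σ_P (e² − 1) = B − 2048`
    have hsub : (univ.filter fun x : Fin (6 + 6) → Bool => Odd (u' x) ∧
        ((8 : ℤ) ∣ u' x - 2 * sZ (f x) - 3 ∨ (8 : ℤ) ∣ u' x - 2 * sZ (f x) + 3)) ⊆ P := by
      intro x hx; exact (hmemP x).2 (mem_filter.1 hx).2.1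
    have hcost : ∀ x ∈ (univ.filter fun x : Fin (6 + 6) → Bool => Odd (u' x) ∧
        ((8 : ℤ) ∣ u' x - 2 * sZ (f x) - 3 ∨ (8 : ℤ) ∣ u' x - 2 * sZ (f x) + 3)), (8 : ℤ) ≤ e x ^ 2 - 1 := by
      intro x hx
      have he' : u' x - 2 * sZ (f x) = e x := rfl
      have hc := (mem_filter.1 hx).2.2
      rw [he'] at hc
      have : e x ≤ -3 ∨ 3 ≤ e x := by rcases hc with ⟨k, hk⟩ | ⟨k, hk⟩ <;> omega
      have := tp_sq_ge (k := 3) (by norm_num) this; linarith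
    have h1 := sum_le_sum hcost
    have h2 : ∑ x ∈ (univ.filter fun x : Fin (6 + 6) → Bool => Odd (u' x) ∧
        ((8 : ℤ) ∣ u' x - 2 * sZ (f x) - 3 ∨ (8 : ℤ) ∣ u' x - 2 * sZ (f x) + 3)), (e x ^ 2 - 1) ≤ ∑ x ∈ P, (e x ^ 2 - 1) :=
      sum_le_sum_of_subset_of_nonneg hsub (fun x hx _ => by have := hsq1 x hx; linarith)
    rw [sum_const, nsmul_eq_mul] at h1
    have hoff0sum : ∑ x ∈ univ.filter (fun x => x ∉ P), e x ^ 2 = 0 :=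
      sum_eq_zero fun x hx => by rw [hoff0 x (mem_filter.1 hx).2]; norm_num
    have hPsum : ∑ x ∈ P, (e x ^ 2 - 1) = (∑ x, e x ^ 2) - 2048 := by
      rw [sum_sub_distrib, sum_const, nsmul_eq_mul, mul_one, hcardP, hsplit, hoff0sum]; push_cast; ring
    have h3 : 8 * ((#(univ.filter fun x : Fin (6 + 6) → Bool => Odd (u' x) ∧
        ((8 : ℤ) ∣ u' x - 2 * sZ (f x) - 3 ∨ (8 : ℤ) ∣ u' x - 2 * sZ (f x) + 3)) : ℤ) : ℝ) ≤ ((∑ x, e x ^ 2 : ℤ) : ℝ) - 2048 := by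
      have h' : 8 * (#(univ.filter fun x : Fin (6 + 6) → Bool => Odd (u' x) ∧
          ((8 : ℤ) ∣ u' x - 2 * sZ (f x) - 3 ∨ (8 : ℤ) ∣ u' x - 2 * sZ (f x) + 3)) : ℤ) ≤ (∑ x, e x ^ 2) - 2048 := by linarith
      exact_mod_cast h'
    rw [hBR] at h3
    exact_mod_cast h3
  · -- (iii) 7-flat parity
    intro x hx a ha
    have hxP := (hmemP x).2 hx
    have haV : ∀ i, a i ∈ V := fun i => hmemV (a i) (ha i)
    have hpts : ∀ ε : Fin (6 + 1) → Bool, (fun j => x j ^^ decide (Odd #(univ.filter fun i => ε i && a i j))) ∈ P :=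
      fun ε => ws_flatPt_mem V h0 (· ∈ P) hPV (6 + 1) x hxP a haV ε
    have h2 := hpar7 x hxP a haV
    have hE := (tw_even_sum_iff univ (fun ε : Fin (6 + 1) → Bool =>
      ω (fun j => x j ^^ decide (Odd #(univ.filter fun i => ε i && a i j))))).1 (even_iff_two_dvd.2 h2)
    rw [filter_congr (fun ε _ => hΩiff _ (hpts ε))] at hE
    exact hE

end Summit.QuantumAdvantage.QuantumAdvantage.Theorems.CubicForrelation.NearExactIsExact

end
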